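import Summits.AtomisticToContinuum.FouriersLaw.Theorems.IncoherentChannel.Negative.LoadBearing
import Summits.AtomisticToContinuum.FouriersLaw.Theorems.IncoherentChannel.Negative.GibbsStein

/-!
# IncoherentChannel, harmonic corner (4/4): the Wick identity `C_N ≡ 2 r_N²` PROVED, the classical FDT, and anharmonicity as an unconditionally load-bearing hypothesis

Negative-side support for crux `PhononMeanFreePath.IncoherentChannel` (item stmt-AtomisticToContinuum-11811),
`Disproof.lean` §5 concluded (sorry-free, no definitions; the crux's integrands are written out).
For the pinned HARMONIC chain (`lam = β = 0`, `ω₂ > 0`, `γ ≥ 0`, `T > 0`) started in its Gibbs state: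
`harmonic_wick` — `C_N(t) = 2 r_N(t)²` for every `N, t` (the connected four-point / cumulant channel
of the Gaussian chain is EMPTY), from flow superposition (`HarmonicFlow`), kernel moments
(`KernelMoments`) and the Stein/Wick identities of the Gibbs measure (`GibbsStein`);
`harmonic_rN_eq_response` — the classical fluctuation–dissipation relation `r_N(t) = T·G_N(t)`, `G_N`
the deterministic impulse response of `p_N` to a unit kick on `p₀` (the input support item 11814,
HarmonicCoherentPersistence, needs), and `harmonic_CN_eq_response_sq` (`C_N = 2T²G_N²`);
`not_crux_at_harmonic`; `crux_false_without_anharmonicity` — discharging the hypothesis of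
`LoadBearing.crux_false_without_anharmonicity_of_wick`: with `0 ≤ lam, 0 ≤ β` admitted the crux is
FALSE, so any proof must use anharmonicity essentially.
-/

noncomputable section

open MeasureTheory Filter Topology Set
open scoped NNReal
open Literature.MathematicalPhysics.KineticTheory.HeatConduction
open Literature.Probability.Process
open Literature.Barriers.AtomisticToContinuum.HeatConduction (hamiltonian_smul)
open Summit.AtomisticToContinuum.FouriersLaw.Theses.PhononMeanFreePath
open Summit.AtomisticToContinuum.FouriersLaw.Theorems.IncoherentChannel.Negative.HarmonicFlow Summit.AtomisticToContinuum.FouriersLaw.Theorems.IncoherentChannel.Negative.KernelMoments Summit.AtomisticToContinuum.FouriersLaw.Theorems.IncoherentChannel.Negative.GibbsStein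

namespace Summit.AtomisticToContinuum.FouriersLaw.Theorems.IncoherentChannel.Negative.HarmonicWick

section Wick


variable {ω₂ γ : ℝ} (hω : 0 < ω₂) (hγ : 0 ≤ γ) {T : ℝ} (hT : 0 < T)
include hω hγ hT

/-- **THE WICK IDENTITY OF THE HARMONIC CORNER, PROVED**: for the pinned HARMONIC chain
(`lam = β = 0`, `ω₂ > 0`, `γ ≥ 0`, `T > 0`) started in its Gibbs state, `C_N(t) = 2 r_N(t)²` for
every `N` and `t` — the connected four-point (cumulant) channel is EMPTY. Ingredients: superposition
for the constructed pathwise flow (`M_t` linear, kernel from `x` = translate of the kernel from rest),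
the CEHR (3.4) moment bound for the constructed kernels, reflection symmetry, and Stein's identity in
the `p₀` direction for the Gibbs measure (momenta exactly Gaussian). [cite: RiederLebowitzLieb1967] -/
theorem harmonic_wick (N : ℕ) (t : ℝ) :
    ((∫ z, (z.2 0) ^ 2 * (∫ y, (y.2 (Fin.last N)) ^ 2 ∂((pinnedChain ω₂ 0 0 γ).transitionKernel (N + 1) T T (Real.toNNReal t) z)) ∂((pinnedChain ω₂ 0 0 γ).gibbsMeasure (N + 1) T)) - (∫ z, (z.2 0) ^ 2 ∂((pinnedChain ω₂ 0 0 γ).gibbsMeasure (N + 1) T)) * (∫ z, (∫ y, (y.2 (Fin.last N)) ^ 2 ∂((pinnedChain ω₂ 0 0 γ).transitionKernel (N + 1) T T (Real.toNNReal t) z)) ∂((pinnedChain ω₂ 0 0 γ).gibbsMeasure (N + 1) T))) = 2 * (∫ z, z.2 0 * (∫ y, y.2 (Fin.last N) ∂((pinnedChain ω₂ 0 0 γ).transitionKernel (N + 1) T T (Real.toNNReal t) z)) ∂((pinnedChain ω₂ 0 0 γ).gibbsMeasure (N + 1) T)) ^ 2 := by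
  have hn : 0 < N + 1 := Nat.succ_pos N
  set P := pinnedChain ω₂ 0 0 γ with hP
  set τ : ℝ≥0 := t.toNNReal with hτ
  set μ := P.gibbsMeasure (N + 1) T with hμ
  haveI : IsProbabilityMeasure μ := pinnedChain_isProbabilityMeasure_gibbsMeasure hω le_rfl le_rfl γ (N + 1) hT
  -- the deterministic flow is linear; g = p_N ∘ M_τ as a continuous linear functional
  obtain ⟨M, hM⟩ := harmonic_chainFlow_zero_noise_linear hω hγ (N + 1) (τ : ℝ)
  set gL : PhaseSpace (N + 1) →L[ℝ] ℝ :=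
    LinearMap.toContinuousLinearMap (((LinearMap.proj (Fin.last N)).comp (LinearMap.snd ℝ _ _)).comp M) with hgL
  have hg : ∀ x, gL x = (M x).2 (Fin.last N) := fun x => rfl
  set G := ‖gL‖ with hG
  have hgb : ∀ x, |gL x| ≤ G * ‖x‖ := fun x => by
    have := gL.le_opNorm x; rwa [Real.norm_eq_abs] at this
  -- kernel moments at rest, and the kernel action on `p_N`, `p_N²`
  set m : ℝ := ∫ y, y.2 (Fin.last N) ∂(P.transitionKernel (N + 1) T T τ 0) with hm
  set w : ℝ := ∫ y, y.2 (Fin.last N) ^ 2 ∂(P.transitionKernel (N + 1) T T τ 0) with hw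
  have hK1 : ∀ z : PhaseSpace (N + 1),
      ∫ y, y.2 (Fin.last N) ∂(P.transitionKernel (N + 1) T T τ z) = gL z + m := by
    intro z
    rw [harmonic_kernel_momentum hω hγ hn hT τ z (Fin.last N), hM z, hg]
  have hK2 : ∀ z : PhaseSpace (N + 1),
      ∫ y, y.2 (Fin.last N) ^ 2 ∂(P.transitionKernel (N + 1) T T τ z) = gL z ^ 2 + 2 * gL z * m + w := by
    intro z
    rw [harmonic_kernel_momentum_sq hω hγ hn hT τ z (Fin.last N), hM z, hg]
  have hgc : Continuous fun x : PhaseSpace (N + 1) => gL x := gL.continuous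
  have hpc : Continuous fun x : PhaseSpace (N + 1) => x.2 (0 : Fin (N + 1)) := by fun_prop
  -- integrability under μ (growth bounds)
  have hI_p : Integrable (fun x : PhaseSpace (N + 1) => x.2 0) μ := by
    refine integrable_gibbsMeasure_of_growth hω le_rfl le_rfl hT hpc (A := 1) fun x => ?_
    have h1 := OscillatorChain.abs_snd_apply_le_norm x 0
    have h2 := (pow_le_one_add_sq_sq (norm_nonneg x)).1
    linarith
  have hI_g : Integrable (fun x : PhaseSpace (N + 1) => gL x) μ := by
    refine integrable_gibbsMeasure_of_growth hω le_rfl le_rfl hT hgc (A := G) fun x => ?_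
    have h2 := (pow_le_one_add_sq_sq (norm_nonneg x)).1
    calc |gL x| ≤ G * ‖x‖ := hgb x
      _ ≤ G * (1 + ‖x‖ ^ 2) ^ 2 := by nlinarith [norm_nonneg gL]
  have hI_pg : Integrable (fun x : PhaseSpace (N + 1) => x.2 0 * gL x) μ := by
    refine integrable_gibbsMeasure_of_growth hω le_rfl le_rfl hT (hpc.mul hgc) (A := G) fun x => ?_
    have h1 := OscillatorChain.abs_snd_apply_le_norm x 0
    have h4 := (pow_le_one_add_sq_sq (norm_nonneg x)).2.1
    rw [abs_mul]
    calc |x.2 0| * |gL x| ≤ ‖x‖ * (G * ‖x‖) := mul_le_mul h1 (hgb x) (abs_nonneg _) (norm_nonneg _)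
      _ = G * ‖x‖ ^ 2 := by ring
      _ ≤ G * (1 + ‖x‖ ^ 2) ^ 2 := by nlinarith [norm_nonneg gL]
  have hI_pp : Integrable (fun x : PhaseSpace (N + 1) => x.2 0 ^ 2) μ := by
    refine integrable_gibbsMeasure_of_growth hω le_rfl le_rfl hT (hpc.pow 2) (A := 1) fun x => ?_
    have h1 := OscillatorChain.abs_snd_apply_le_norm x 0
    have h4 := (pow_le_one_add_sq_sq (norm_nonneg x)).2.1
    rw [abs_pow]
    calc |x.2 0| ^ 2 ≤ ‖x‖ ^ 2 := pow_le_pow_left₀ (abs_nonneg _) h1 2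
      _ ≤ 1 * (1 + ‖x‖ ^ 2) ^ 2 := by linarith
  have hI_gg : Integrable (fun x : PhaseSpace (N + 1) => gL x ^ 2) μ := by
    refine integrable_gibbsMeasure_of_growth hω le_rfl le_rfl hT (hgc.pow 2) (A := G ^ 2) fun x => ?_
    rw [abs_pow]
    have h4 := (pow_le_one_add_sq_sq (norm_nonneg x)).2.1
    calc |gL x| ^ 2 ≤ (G * ‖x‖) ^ 2 := pow_le_pow_left₀ (abs_nonneg _) (hgb x) 2
      _ = G ^ 2 * ‖x‖ ^ 2 := by ring
      _ ≤ G ^ 2 * (1 + ‖x‖ ^ 2) ^ 2 := by nlinarith [sq_nonneg G]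
  have hI_ppg : Integrable (fun x : PhaseSpace (N + 1) => x.2 0 ^ 2 * gL x) μ := by
    refine integrable_gibbsMeasure_of_growth hω le_rfl le_rfl hT ((hpc.pow 2).mul hgc) (A := G) fun x => ?_
    have h1 := OscillatorChain.abs_snd_apply_le_norm x 0
    have h5 := (pow_le_one_add_sq_sq (norm_nonneg x)).2.2.1
    rw [abs_mul, abs_pow]
    have e1 : |x.2 0| ^ 2 ≤ ‖x‖ ^ 2 := pow_le_pow_left₀ (abs_nonneg _) h1 2
    calc |x.2 0| ^ 2 * |gL x| ≤ ‖x‖ ^ 2 * (G * ‖x‖) := mul_le_mul e1 (hgb x) (abs_nonneg _) (by positivity)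
      _ = G * ‖x‖ ^ 3 := by ring
      _ ≤ G * (1 + ‖x‖ ^ 2) ^ 2 := by nlinarith [norm_nonneg gL]
  have hI_ppgg : Integrable (fun x : PhaseSpace (N + 1) => x.2 0 ^ 2 * gL x ^ 2) μ := by
    refine integrable_gibbsMeasure_of_growth hω le_rfl le_rfl hT ((hpc.pow 2).mul (hgc.pow 2)) (A := G ^ 2) fun x => ?_
    have h1 := OscillatorChain.abs_snd_apply_le_norm x 0
    have h6 := (pow_le_one_add_sq_sq (norm_nonneg x)).2.2.2
    rw [abs_mul, abs_pow, abs_pow]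
    have e1 : |x.2 0| ^ 2 ≤ ‖x‖ ^ 2 := pow_le_pow_left₀ (abs_nonneg _) h1 2
    have e2 : |gL x| ^ 2 ≤ (G * ‖x‖) ^ 2 := pow_le_pow_left₀ (abs_nonneg _) (hgb x) 2
    calc |x.2 0| ^ 2 * |gL x| ^ 2 ≤ ‖x‖ ^ 2 * (G * ‖x‖) ^ 2 := mul_le_mul e1 e2 (by positivity) (by positivity)
      _ = G ^ 2 * ‖x‖ ^ 4 := by ring
      _ ≤ G ^ 2 * (1 + ‖x‖ ^ 2) ^ 2 := by nlinarith [sq_nonneg G]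
  -- odd moments vanish (reflection symmetry)
  have hodd_p : ∫ x, x.2 (0 : Fin (N + 1)) ∂μ = 0 :=
    integral_gibbsMeasure_eq_zero_of_odd (N + 1) T (fun x => by simp)
  have hodd_g : ∫ x, gL x ∂μ = 0 :=
    integral_gibbsMeasure_eq_zero_of_odd (N + 1) T (fun x => by simp)
  have hodd_ppg : ∫ x, x.2 (0 : Fin (N + 1)) ^ 2 * gL x ∂μ = 0 :=
    integral_gibbsMeasure_eq_zero_of_odd (N + 1) T (fun x => by simp)
  -- Gaussian facts of the Gibbs measure
  have hp2 : ∫ x, x.2 (0 : Fin (N + 1)) ^ 2 ∂μ = T := gibbs_sq_momentum hω le_rfl le_rfl hT 0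
  have h4 : ∫ x, x.2 0 ^ 2 * gL x ^ 2 ∂μ = T * ∫ x, gL x ^ 2 ∂μ + 2 * (∫ x, x.2 0 * gL x ∂μ) ^ 2 :=
    gibbs_sq_momentum_mul_clm_sq hω le_rfl le_rfl hT 0 gL
  -- the crux integrands at lam = β = 0
  have er : (∫ z, z.2 0 * (∫ y, y.2 (Fin.last N) ∂((pinnedChain ω₂ 0 0 γ).transitionKernel (N + 1) T T (Real.toNNReal t) z)) ∂((pinnedChain ω₂ 0 0 γ).gibbsMeasure (N + 1) T)) = ∫ x, x.2 0 * gL x ∂μ := by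
    rw [← hP, ← hτ, ← hμ]
    simp_rw [hK1]
    have : (fun z : PhaseSpace (N + 1) => z.2 0 * (gL z + m)) = fun z => z.2 0 * gL z + m * z.2 0 :=
      funext fun z => by ring
    rw [this, integral_add hI_pg (hI_p.const_mul m), integral_const_mul, hodd_p, mul_zero, add_zero]
  have eC : ((∫ z, (z.2 0) ^ 2 * (∫ y, (y.2 (Fin.last N)) ^ 2 ∂((pinnedChain ω₂ 0 0 γ).transitionKernel (N + 1) T T (Real.toNNReal t) z)) ∂((pinnedChain ω₂ 0 0 γ).gibbsMeasure (N + 1) T)) - (∫ z, (z.2 0) ^ 2 ∂((pinnedChain ω₂ 0 0 γ).gibbsMeasure (N + 1) T)) * (∫ z, (∫ y, (y.2 (Fin.last N)) ^ 2 ∂((pinnedChain ω₂ 0 0 γ).transitionKernel (N + 1) T T (Real.toNNReal t) z)) ∂((pinnedChain ω₂ 0 0 γ).gibbsMeasure (N + 1) T))) = ∫ x, x.2 0 ^ 2 * gL x ^ 2 ∂μ - T * ∫ x, gL x ^ 2 ∂μ := by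
    rw [← hP, ← hτ, ← hμ]
    simp_rw [hK2]
    have e1 : (fun z : PhaseSpace (N + 1) => z.2 0 ^ 2 * (gL z ^ 2 + 2 * gL z * m + w)) =
        fun z => (z.2 0 ^ 2 * gL z ^ 2 + 2 * m * (z.2 0 ^ 2 * gL z)) + w * z.2 0 ^ 2 := funext fun z => by ring
    have e2 : (fun z : PhaseSpace (N + 1) => gL z ^ 2 + 2 * gL z * m + w) =
        fun z => (gL z ^ 2 + 2 * m * gL z) + w := funext fun z => by ring
    have hI1 : Integrable (fun z : PhaseSpace (N + 1) => z.2 0 ^ 2 * gL z ^ 2 + 2 * m * (z.2 0 ^ 2 * gL z)) μ :=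
      hI_ppgg.add (hI_ppg.const_mul _)
    have hI2 : Integrable (fun z : PhaseSpace (N + 1) => w * z.2 0 ^ 2) μ := hI_pp.const_mul w
    have hI3 : Integrable (fun z : PhaseSpace (N + 1) => 2 * m * (z.2 0 ^ 2 * gL z)) μ := hI_ppg.const_mul _
    have hI4 : Integrable (fun z : PhaseSpace (N + 1) => gL z ^ 2 + 2 * m * gL z) μ := hI_gg.add (hI_g.const_mul _)
    have hI5 : Integrable (fun z : PhaseSpace (N + 1) => 2 * m * gL z) μ := hI_g.const_mul _
    rw [e1, e2, integral_add hI1 hI2, integral_add hI_ppgg hI3, integral_add hI4 (integrable_const w),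
      integral_add hI_gg hI5, integral_const_mul, integral_const_mul, integral_const_mul,
      integral_const, probReal_univ, one_smul, hodd_ppg, hodd_g, hp2]
    ring
  rw [eC, er, h4]
  ring


/-- **Classical fluctuation–dissipation for the harmonic chain, PROVED**: `r_N(t) = T · G_N(t)` where
`G_N(t) = (Φ_t(e_{p₀}, 0))_{p_N}` is the deterministic impulse response of `p_N` to a unit kick on
`p₀` (the constructed flow from `(0, e₀)` with zero noise). Hence (Wick) `C_N(t) = 2T² G_N(t)²`, and
support item `HarmonicCoherentPersistence` (stmt-11814) is the statement `N ∫₀^∞ G_N² ↛ 0` about the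
damped harmonic lattice alone. [cite: RiederLebowitzLieb1967] -/
theorem harmonic_rN_eq_response (N : ℕ) (t : ℝ) :
    (∫ z, z.2 0 * (∫ y, y.2 (Fin.last N) ∂((pinnedChain ω₂ 0 0 γ).transitionKernel (N + 1) T T (Real.toNNReal t) z)) ∂((pinnedChain ω₂ 0 0 γ).gibbsMeasure (N + 1) T)) =
      T * ((pinnedChain ω₂ 0 0 γ).chainFlow (N + 1) ((0, Pi.single 0 1) : PhaseSpace (N + 1)) 0
        (t.toNNReal : ℝ)).2 (Fin.last N) := by
  have hn : 0 < N + 1 := Nat.succ_pos N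
  set P := pinnedChain ω₂ 0 0 γ with hP
  set τ : ℝ≥0 := t.toNNReal with hτ
  set μ := P.gibbsMeasure (N + 1) T with hμ
  haveI : IsProbabilityMeasure μ := pinnedChain_isProbabilityMeasure_gibbsMeasure hω le_rfl le_rfl γ (N + 1) hT
  obtain ⟨M, hM⟩ := harmonic_chainFlow_zero_noise_linear hω hγ (N + 1) (τ : ℝ)
  set gL : PhaseSpace (N + 1) →L[ℝ] ℝ :=
    LinearMap.toContinuousLinearMap (((LinearMap.proj (Fin.last N)).comp (LinearMap.snd ℝ _ _)).comp M) with hgL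
  have hg : ∀ x, gL x = (M x).2 (Fin.last N) := fun x => rfl
  set G := ‖gL‖ with hG
  have hgb : ∀ x, |gL x| ≤ G * ‖x‖ := fun x => by
    have := gL.le_opNorm x; rwa [Real.norm_eq_abs] at this
  set m : ℝ := ∫ y, y.2 (Fin.last N) ∂(P.transitionKernel (N + 1) T T τ 0) with hm
  have hK1 : ∀ z : PhaseSpace (N + 1),
      ∫ y, y.2 (Fin.last N) ∂(P.transitionKernel (N + 1) T T τ z) = gL z + m := by
    intro z
    rw [harmonic_kernel_momentum hω hγ hn hT τ z (Fin.last N), hM z, hg]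
  have hgc : Continuous fun x : PhaseSpace (N + 1) => gL x := gL.continuous
  have hpc : Continuous fun x : PhaseSpace (N + 1) => x.2 (0 : Fin (N + 1)) := by fun_prop
  have hI_p : Integrable (fun x : PhaseSpace (N + 1) => x.2 0) μ := by
    refine integrable_gibbsMeasure_of_growth hω le_rfl le_rfl hT hpc (A := 1) fun x => ?_
    have h1 := OscillatorChain.abs_snd_apply_le_norm x 0
    have h2 := (pow_le_one_add_sq_sq (norm_nonneg x)).1
    linarith
  have hI_pg : Integrable (fun x : PhaseSpace (N + 1) => x.2 0 * gL x) μ := by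
    refine integrable_gibbsMeasure_of_growth hω le_rfl le_rfl hT (hpc.mul hgc) (A := G) fun x => ?_
    have h1 := OscillatorChain.abs_snd_apply_le_norm x 0
    have h4 := (pow_le_one_add_sq_sq (norm_nonneg x)).2.1
    rw [abs_mul]
    calc |x.2 0| * |gL x| ≤ ‖x‖ * (G * ‖x‖) := mul_le_mul h1 (hgb x) (abs_nonneg _) (norm_nonneg _)
      _ = G * ‖x‖ ^ 2 := by ring
      _ ≤ G * (1 + ‖x‖ ^ 2) ^ 2 := by nlinarith [norm_nonneg gL]
  have hodd_p : ∫ x, x.2 (0 : Fin (N + 1)) ∂μ = 0 :=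
    integral_gibbsMeasure_eq_zero_of_odd (N + 1) T (fun x => by simp)
  have er : (∫ z, z.2 0 * (∫ y, y.2 (Fin.last N) ∂((pinnedChain ω₂ 0 0 γ).transitionKernel (N + 1) T T (Real.toNNReal t) z)) ∂((pinnedChain ω₂ 0 0 γ).gibbsMeasure (N + 1) T)) = ∫ x, x.2 0 * gL x ∂μ := by
    rw [← hP, ← hτ, ← hμ]
    simp_rw [hK1]
    have : (fun z : PhaseSpace (N + 1) => z.2 0 * (gL z + m)) = fun z => z.2 0 * gL z + m * z.2 0 :=
      funext fun z => by ring
    rw [this, integral_add hI_pg (hI_p.const_mul m), integral_const_mul, hodd_p, mul_zero, add_zero]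
  rw [er, gibbs_momentum_mul_clm hω le_rfl le_rfl hT 0 gL, hg, ← hM]

/-- Hence `C_N(t) = 2 T² G_N(t)²` for the harmonic chain. [cite: RiederLebowitzLieb1967] -/
theorem harmonic_CN_eq_response_sq (N : ℕ) (t : ℝ) :
    ((∫ z, (z.2 0) ^ 2 * (∫ y, (y.2 (Fin.last N)) ^ 2 ∂((pinnedChain ω₂ 0 0 γ).transitionKernel (N + 1) T T (Real.toNNReal t) z)) ∂((pinnedChain ω₂ 0 0 γ).gibbsMeasure (N + 1) T)) - (∫ z, (z.2 0) ^ 2 ∂((pinnedChain ω₂ 0 0 γ).gibbsMeasure (N + 1) T)) * (∫ z, (∫ y, (y.2 (Fin.last N)) ^ 2 ∂((pinnedChain ω₂ 0 0 γ).transitionKernel (N + 1) T T (Real.toNNReal t) z)) ∂((pinnedChain ω₂ 0 0 γ).gibbsMeasure (N + 1) T))) =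
      2 * T ^ 2 * ((pinnedChain ω₂ 0 0 γ).chainFlow (N + 1) ((0, Pi.single 0 1) : PhaseSpace (N + 1)) 0
        (t.toNNReal : ℝ)).2 (Fin.last N) ^ 2 := by
  rw [harmonic_wick hω hγ hT N t, harmonic_rN_eq_response hω hγ hT N t]
  ring

/-- The harmonic chain is NOT a model of the crux's conclusion, at any admissible `(ω₂, γ, T)`:
`a_N ≡ 0 ↛ κ > 0` (via `LoadBearing.not_crux_harmonic_of_wick`). [folklore] -/
theorem not_crux_at_harmonic : ¬ (∃ κ : ℝ, 0 < κ ∧ Filter.Tendsto (fun N : ℕ => ((N : ℝ) * (γ ^ 2 / T ^ 2) * ∫ t in Set.Ioi (0 : ℝ), (((∫ z, (z.2 0) ^ 2 * (∫ y, (y.2 (Fin.last N)) ^ 2 ∂((pinnedChain ω₂ 0 0 γ).transitionKernel (N + 1) T T (Real.toNNReal t) z)) ∂((pinnedChain ω₂ 0 0 γ).gibbsMeasure (N + 1) T)) - (∫ z, (z.2 0) ^ 2 ∂((pinnedChain ω₂ 0 0 γ).gibbsMeasure (N + 1) T)) * (∫ z, (∫ y, (y.2 (Fin.last N)) ^ 2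 ∂((pinnedChain ω₂ 0 0 γ).transitionKernel (N + 1) T T (Real.toNNReal t) z)) ∂((pinnedChain ω₂ 0 0 γ).gibbsMeasure (N + 1) T))) - 2 * (∫ z, z.2 0 * (∫ y, y.2 (Fin.last N) ∂((pinnedChain ω₂ 0 0 γ).transitionKernel (N + 1) T T (Real.toNNReal t) z)) ∂((pinnedChain ω₂ 0 0 γ).gibbsMeasure (N + 1) T)) ^ 2))) Filter.atTop (nhds κ)) :=
  Summit.AtomisticToContinuum.FouriersLaw.Theorems.IncoherentChannel.Negative.LoadBearing.not_crux_harmonic_of_wick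
    (fun N t _ => harmonic_wick hω hγ hT N t)

omit hγ in
/-- **`lam > 0 ∨ β > 0` IS LOAD-BEARING — unconditionally.** With the harmonic corner admitted
(`0 ≤ lam`, `0 ≤ β`) the crux is FALSE: the cumulant channel of the Gaussian chain vanishes
identically. Any proof of `IncoherentChannel` must use anharmonicity in an essential,
non-perturbative way. [folklore] -/
theorem crux_false_without_anharmonicity (hγ' : 0 < γ) :
    ¬ ∀ ω₂ lam β γ : ℝ, 0 < ω₂ → 0 ≤ lam → 0 ≤ β → 0 < γ → ∀ T : ℝ, 0 < T → (∃ κ : ℝ, 0 < κ ∧ Filter.Tendsto (fun N : ℕ => ((N : ℝ) * (γ ^ 2 / T ^ 2) * ∫ t in Set.Ioi (0 : ℝ), (((∫ z, (z.2 0) ^ 2 * (∫ y, (y.2 (Fin.last N)) ^ 2 ∂((pinnedChain ω₂ lam β γ).transitionKernel (N + 1) T T (Real.toNNReal t) z)) ∂((pinnedChain ω₂ lam β γ).gibbsMeasure (N + 1) T)) - (∫ z, (z.2 0) ^ 2 ∂((pinnedChain ω₂ lam β γ).gibbsMeasure (N + 1) T)) * (∫ z, (∫ y, (y.2 (Fin.last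 N)) ^ 2 ∂((pinnedChain ω₂ lam β γ).transitionKernel (N + 1) T T (Real.toNNReal t) z)) ∂((pinnedChain ω₂ lam β γ).gibbsMeasure (N + 1) T))) - 2 * (∫ z, z.2 0 * (∫ y, y.2 (Fin.last N) ∂((pinnedChain ω₂ lam β γ).transitionKernel (N + 1) T T (Real.toNNReal t) z)) ∂((pinnedChain ω₂ lam β γ).gibbsMeasure (N + 1) T)) ^ 2))) Filter.atTop (nhds κ)) :=
  Summit.AtomisticToContinuum.FouriersLaw.Theorems.IncoherentChannel.Negative.LoadBearing.crux_false_without_anharmonicity_of_wick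
    hω hγ' hT (fun N t _ => harmonic_wick hω hγ'.le hT N t)


end Wick

end Summit.AtomisticToContinuum.FouriersLaw.Theorems.IncoherentChannel.Negative.HarmonicWick
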